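import Mathlib
import HarnessLib
import Literature.Geometry.Lorentzian.KerrWaveEnergyProofs
import Summits.FinalStateConjecture.FinalStateConjecture.Theorems.ZeroEnergyKerrOrBombKerrModeStabilityRestrict
import Literature.Geometry.Lorentzian.KerrHorizonRegularWaveBoundedness

/-!
# Route ZeroEnergyKerrOrBomb · item `KerrModeStability` — DRSR energy boundedness through the
# Kerr–Schild leaves for horizon-regular solutions, from the printed theorem

Helper file for item stmt-FinalStateConjecture-10024 (`KerrModeStability`). It states, as a cited
`Prop` to be relocated by the gate to `Literature/Geometry/Lorentzian/`, Theorem 3.1 (23) of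
Dafermos–Rodnianski–Shlapentokh-Rothman (arXiv:1402.7034) in its §3.3 form for admissible
Kerr–Schild graphs and for the printed, **horizon-regular** class of solutions (smooth on a
horizon-penetrating chart, data compactly supported on `Σ̃₀ = {t* = F} ∩ {r ≥ r₊}` towards infinity
only — the existing `DafermosRodnianskiShlapentokhRothman2016_energyBoundedness` of
`KerrWaveEnergy.lean` covers only data supported away from `𝓗⁺`), and derives from it the
boundedness of the coordinate energy through the Kerr–Schild leaves `{t* = τ} ∩ {r > r₊}`
(`kerr_leafEnergy_boundedness_of`), by the argument of `drsr_wave_boundedness_kerr_of_DRSR`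
(`KerrWaveEnergyProofs.lean`) applied to the restriction of the solution to the exterior chart:
interpolating admissible height function `heightFn M λ` (a leaf near the hole, a DRSR slice far
out), the proved far-region `J^T` comparison `kerr_far_TEnergy_comparison_of_farRadius_le` and the
proved far-region finite speed of propagation `kerr_far_finite_speed_of_propagation`
(Dafermos–Rodnianski, arXiv:1010.5132, §4.6, Prop. 4.6.1).
-/

noncomputable section

namespace Summit.FinalStateConjecture.FinalStateConjecture.Theorems

open Literature.Geometry.Lorentzian Set Filter MeasureTheory
open scoped Manifold ContDiff Topology ENNReal

-- every `Summit.FinalStateConjecture.FinalStateConjecture.…` name repeats the summit = sub-problem segment (D-0017 layout)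
set_option linter.dupNamespace false

/-- **DRSR energy boundedness through the Kerr–Schild leaves, horizon-regular class** (from the
printed theorem `DafermosRodnianskiShlapentokhRothman2016_energyBoundedness_horizonRegular`). For
subextremal `(M, a)` and `r₋ < r₀ < r₊` there is `C = C(M, a, r₀) < ∞` such that every smooth
`ψ : Kerr.region a r₀ → ℝ` solving `□_g ψ = 0` on `{r > r₊}`, whose data on the leaf `{t* = 0}`
vanish at all points with `‖x⃗‖ > ρ` for some `ρ`, satisfies `E(τ) ≤ C · E(0)` for all `τ ≥ 0`,
where `E(τ) = sliceEnergy (Kerr.exterior M a) ψ|_{r > r₊} τ` is the coordinate energy of the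
restriction of `ψ` to the exterior chart through `{t* = τ} ∩ {r > r₊}`. Proof: verbatim the
argument of `drsr_wave_boundedness_kerr_of_DRSR` (Dafermos–Rodnianski, arXiv:1010.5132, §4.6,
Prop. 4.6.1) for the restriction `ψ'` of `ψ` to the exterior (a smooth solution there,
`kerr_restrict_contMDiff`, `kerr_dalembertian_restrict_eq_zero`): with `F = heightFn M λ`
(admissible, `= 0` on `{‖y‖ ≤ λ}`, slope `≤ 1/4`, `0 ≤ sF ≤ ‖y‖/2`), far-region finite speed of
propagation (`kerr_far_finite_speed_of_propagation`) makes `ψ', dψ'` vanish on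
`{x⁰ ≥ 0, ‖x⃗‖ > ρ + s x⁰}`, hence the data of `ψ` on the graph of `F` vanish beyond `2ρ` and the
wedges `{τ ≤ x⁰ ≤ τ + F}` carry nothing beyond `2(ρ + sτ) + 1`; then
`E_KS(τ) ≤ 8 E_F(τ) ≤ 8 C_A E_F(0) ≤ 64 C_A E_KS(0)` by the far `J^T` comparison
(`kerr_far_TEnergy_comparison_of_farRadius_le`, constant `8`) and the printed theorem. -/
theorem kerr_leafEnergy_boundedness_of
    (hA : Literature.Geometry.Lorentzian.DafermosRodnianskiShlapentokhRothman2016_energyBoundedness_horizonRegular)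
    [Kerr.Facts] [Kerr.SliceFacts] {M a r₀ : ℝ} (hMa : Kerr.IsSubextremal M a)
    (hrm : Kerr.rMinus M a < r₀) (hr : r₀ < Kerr.rPlus M a) :
    ∃ C : ℝ≥0∞, C < ⊤ ∧ ∀ ψ : Kerr.region a r₀ → ℝ,
      ContMDiff 𝓘(ℝ, E4) 𝓘(ℝ, ℝ) ∞ ψ →
      (∀ x : Kerr.region a r₀, Kerr.rPlus M a < Kerr.radius a (x : E4) →
        (Kerr.smoothMetric M a r₀).toPseudoRiemannianMetric.dalembertian ψ x = 0) →
      (∃ ρ : ℝ, ∀ x : Kerr.region a r₀, (x : E4) 0 = 0 → ρ < E4.spatialNorm (x : E4) →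
          ψ x = 0 ∧ mfderiv 𝓘(ℝ, E4) 𝓘(ℝ, ℝ) ψ x = 0) →
      ∀ τ : ℝ, 0 ≤ τ →
        sliceEnergy (Kerr.exterior M a)
            (fun y : Kerr.exterior M a ↦ ψ ⟨(y : E4), Kerr.region_mono a hr.le y.2⟩) τ ≤
          C * sliceEnergy (Kerr.exterior M a)
            (fun y : Kerr.exterior M a ↦ ψ ⟨(y : E4), Kerr.region_mono a hr.le y.2⟩) 0 := by
  obtain ⟨s, hs1, hCfar⟩ := kerr_far_finite_speed_of_propagation
  have hs0 : 0 ≤ s := zero_le_one.trans hs1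
  have hM : 0 < M := hMa.pos
  -- the height function and its scale
  obtain ⟨B, hB0, hBd⟩ := exists_bound_deriv_heightProfile
  set A : ℝ := 4 * M * B + 2 * M with hA_def
  have hA0 : 0 ≤ A := by positivity
  set l : ℝ := max (max (4 * A) (4 * M * s)) (Kerr.farRadius M a) with hl_def
  have hl_A : 4 * A ≤ l := (le_max_left _ _).trans (le_max_left _ _)
  have hl_s : 4 * M * s ≤ l := (le_max_right _ _).trans (le_max_left _ _)
  have hl_far : Kerr.farRadius M a ≤ l := le_max_right _ _
  have hl_af : Kerr.afRadius a (Kerr.rPlus M a) < l :=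
    (Kerr.afRadius_lt_farRadius M a).trans_le hl_far
  have hl : 0 < l := (Kerr.farRadius_pos M a).trans_le hl_far
  set F : E3 → ℝ := heightFn M l with hF_def
  have hF_smooth : ContDiff ℝ ∞ F := contDiff_heightFn M l
  have hF_C1 : ContDiff ℝ 1 F := hF_smooth.of_le (ENat.natCast_le_of_coe_top_le_withTop le_rfl 1)
  have hF_slope : ∀ y : E3, ‖fderiv ℝ F y‖ ≤ 1 / 4 := by
    intro y
    have h := norm_fderiv_heightFn_le_div hM.le hl hB0 hBd y
    have h2 : A / l ≤ 1 / 4 := by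
      rw [div_le_iff₀ hl]; linarith
    rw [← hA_def] at h
    linarith
  have hF_zero : ∀ y : E3, ‖y‖ ≤ l → F y = 0 := fun y hy ↦ heightFn_of_norm_le hl hy
  have hF_nonneg : ∀ y : E3, 0 ≤ F y := heightFn_nonneg hM.le l
  have hF_sF : ∀ y : E3, s * F y ≤ ‖y‖ / 2 := by
    intro y
    have h := heightFn_le hM.le hl y
    have h1 : s * F y ≤ s * (2 * M * ‖y‖ / l) := mul_le_mul_of_nonneg_left h hs0
    have h2 : s * (2 * M * ‖y‖ / l) ≤ ‖y‖ / 2 := by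
      rw [← mul_div_assoc, div_le_div_iff₀ hl (by norm_num : (0:ℝ) < 2)]
      nlinarith [norm_nonneg y]
    exact h1.trans h2
  have hF_adm : Kerr.IsAdmissibleHeight M F :=
    ⟨hF_smooth, ⟨3 / 4, by norm_num, fun y ↦ by linarith [hF_slope y]⟩, _,
      tendsto_heightFn_sub_log hl⟩
  -- the printed theorem, with its constant
  obtain ⟨CA, hCA, hAψ⟩ := hA M a r₀ hr hMa hrm F hF_adm
  have hzero_C1 : ContDiff ℝ 1 (0 : E3 → ℝ) := contDiff_const
  have hzero_slope : ∀ y : E3, ‖fderiv ℝ (0 : E3 → ℝ) y‖ ≤ 1 / 4 := by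
    intro y; simp
  refine ⟨8 * CA * 8, ENNReal.mul_lt_top (ENNReal.mul_lt_top (by simp) hCA) (by simp),
    fun ψ hψ hsol hdata τ hτ ↦ ?_⟩
  -- the restriction to the exterior chart
  set ψ' : Kerr.exterior M a → ℝ :=
    fun y : Kerr.exterior M a ↦ ψ ⟨(y : E4), Kerr.region_mono a hr.le y.2⟩ with hψ'_def
  have hsmooth : ContMDiff 𝓘(ℝ, E4) 𝓘(ℝ, ℝ) ∞ ψ' := kerr_restrict_contMDiff hr.le hψ
  have hsol' : ∀ x, (Kerr.smoothMetric M a (Kerr.rPlus M a)).toPseudoRiemannianMetric.dalembertian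
      ψ' x = 0 := kerr_dalembertian_restrict_eq_zero hMa hr.le hψ hsol
  have hrestr : ∀ x : Kerr.exterior M a,
      ψ ⟨(x : E4), Kerr.region_mono a hr.le x.2⟩ = 0 ∧
        mfderiv 𝓘(ℝ, E4) 𝓘(ℝ, ℝ) ψ ⟨(x : E4), Kerr.region_mono a hr.le x.2⟩ = 0 →
      ψ' x = 0 ∧ mfderiv 𝓘(ℝ, E4) 𝓘(ℝ, ℝ) ψ' x = 0 := by
    intro x hx
    refine ⟨hx.1, ?_⟩
    rw [hψ'_def, kerr_mfderiv_restrict hr.le (by simp) hψ x]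
    exact hx.2
  -- the support radius of the data
  obtain ⟨ρ₀, hρ₀⟩ := hdata
  set ρ : ℝ := max ρ₀ l with hρ_def
  have hρl : l ≤ ρ := le_max_right _ _
  have hρfar : Kerr.farRadius M a ≤ ρ := hl_far.trans hρl
  have hρ0 : 0 ≤ ρ := hl.le.trans hρl
  have hdata' : ∀ x : Kerr.exterior M a, (x : E4) 0 = 0 → ρ < E4.spatialNorm (x : E4) →
      ψ' x = 0 ∧ mfderiv 𝓘(ℝ, E4) 𝓘(ℝ, ℝ) ψ' x = 0 := fun x hx0 hxρ ↦
    hrestr x (hρ₀ ⟨(x : E4), Kerr.region_mono a hr.le x.2⟩ hx0 ((le_max_left _ _).trans_lt hxρ))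
  -- finite speed of propagation (far region, speed `s`)
  have hvan : ∀ x : Kerr.exterior M a, 0 ≤ (x : E4) 0 →
      ρ + s * (x : E4) 0 < E4.spatialNorm (x : E4) →
      ψ' x = 0 ∧ mfderiv 𝓘(ℝ, E4) 𝓘(ℝ, ℝ) ψ' x = 0 :=
    hCfar M a hMa ψ' hsmooth hsol' ρ hρfar hdata'
  -- the data of `ψ` on the graph of `F` vanish beyond `2ρ`
  have hψF : ∃ ρ' : ℝ, ∀ x : Kerr.region a r₀, (x : E4) 0 = F (E4.spatial (x : E4)) →
      ρ' < E4.spatialNorm (x : E4) → ψ x = 0 ∧ mfderiv 𝓘(ℝ, E4) 𝓘(ℝ, ℝ) ψ x = 0 := by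
    refine ⟨2 * ρ, fun x hx0 hxρ ↦ ?_⟩
    set y : E3 := E4.spatial (x : E4) with hy_def
    have hsn : E4.spatialNorm (x : E4) = ‖y‖ := rfl
    have hyl : l < ‖y‖ := by
      rw [← hsn]
      have : l ≤ 2 * ρ := by linarith
      exact this.trans_lt hxρ
    have hxext : (x : E4) ∈ Kerr.exterior M a := by
      rw [eq_ofTimeSpace (x : E4)]
      exact Kerr.ofTimeSpace_mem_exterior_iff.mpr (Kerr.mem_slice_of_lt_norm (hl_af.trans hyl))
    have h := hvan ⟨(x : E4), hxext⟩ (by rw [hx0]; exact hF_nonneg y) (by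
      rw [hsn, hx0]
      linarith [hF_sF y])
    refine ⟨h.1, ?_⟩
    have h2 := h.2
    rw [hψ'_def, kerr_mfderiv_restrict hr.le (by simp) hψ ⟨(x : E4), hxext⟩] at h2
    exact h2
  -- the far comparison at times `t ≥ 0` (a theorem)
  have hBt : ∀ t : ℝ, 0 ≤ t →
      graphSliceEnergyOn (Kerr.exterior M a) ψ' F t {y | l < ‖y‖} ≤
          8 * graphSliceEnergyOn (Kerr.exterior M a) ψ' 0 t {y | l < ‖y‖} ∧
        graphSliceEnergyOn (Kerr.exterior M a) ψ' 0 t {y | l < ‖y‖} ≤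
          8 * graphSliceEnergyOn (Kerr.exterior M a) ψ' F t {y | l < ‖y‖} := by
    intro t ht
    refine kerr_far_TEnergy_comparison_of_farRadius_le hMa hl_far (F₁ := 0) (F₂ := F) hzero_C1
      hF_C1 hzero_slope hF_slope (fun y hy ↦ by simp [hF_zero y hy])
      (fun y ↦ by simpa using hF_nonneg y) ψ' t hsmooth hsol'
      ⟨2 * (ρ + s * t) + 1, fun x hx1 hx2 hx3 ↦ ?_⟩
    simp only [Pi.zero_apply, add_zero] at hx1
    refine hvan x (ht.trans hx1) ?_
    have hsn : E4.spatialNorm (x : E4) = ‖E4.spatial (x : E4)‖ := rfl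
    have hh := hF_sF (E4.spatial (x : E4))
    have h2 := mul_le_mul_of_nonneg_left hx2 hs0
    rw [hsn] at hx3 ⊢
    nlinarith
  -- measurability of the far region; the graphs of `0` and `F` agree over the near region
  have hS : MeasurableSet {y : E3 | l < ‖y‖} :=
    (isOpen_lt continuous_const continuous_norm).measurableSet
  have hagree : ∀ t : ℝ, graphSliceEnergyOn (Kerr.exterior M a) ψ' 0 t {y : E3 | l < ‖y‖}ᶜ =
      graphSliceEnergyOn (Kerr.exterior M a) ψ' F t {y : E3 | l < ‖y‖}ᶜ := by
    intro t
    refine graphSliceEnergyOn_congr_height _ ψ' t hS.compl fun y hy ↦ ?_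
    simp only [Set.mem_compl_iff, Set.mem_setOf_eq, not_lt] at hy
    simp only [Pi.zero_apply]
    exact (hF_zero y hy).symm
  have hD1 : (1 : ENNReal) ≤ 8 := by norm_num
  -- near/far decomposition at times `t ≥ 0`, in both directions
  have hcmp1 : ∀ t : ℝ, 0 ≤ t →
      sliceEnergy (Kerr.exterior M a) ψ' t ≤ 8 * graphSliceEnergy (Kerr.exterior M a) ψ' F t := by
    intro t ht
    rw [← graphSliceEnergy_zero_height, ← graphSliceEnergyOn_add_compl _ ψ' 0 t hS,
      ← graphSliceEnergyOn_add_compl _ ψ' F t hS, hagree t, mul_add]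
    gcongr ?_ + ?_
    · exact (hBt t ht).2
    · exact le_mul_of_one_le_left' hD1
  have hcmp2 : ∀ t : ℝ, 0 ≤ t →
      graphSliceEnergy (Kerr.exterior M a) ψ' F t ≤ 8 * sliceEnergy (Kerr.exterior M a) ψ' t := by
    intro t ht
    rw [← graphSliceEnergy_zero_height, ← graphSliceEnergyOn_add_compl _ ψ' 0 t hS,
      ← graphSliceEnergyOn_add_compl _ ψ' F t hS, hagree t, mul_add]
    gcongr ?_ + ?_
    · exact (hBt t ht).1
    · exact le_mul_of_one_le_left' hD1
  calc sliceEnergy (Kerr.exterior M a) ψ' τ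
      ≤ 8 * graphSliceEnergy (Kerr.exterior M a) ψ' F τ := hcmp1 τ hτ
    _ ≤ 8 * (CA * graphSliceEnergy (Kerr.exterior M a) ψ' F 0) := by
        gcongr; exact hAψ ψ hψ hsol hψF τ hτ
    _ ≤ 8 * (CA * (8 * sliceEnergy (Kerr.exterior M a) ψ' 0)) := by
        gcongr; exact hcmp2 0 le_rfl
    _ = 8 * CA * 8 * sliceEnergy (Kerr.exterior M a) ψ' 0 := by ring

end Summit.FinalStateConjecture.FinalStateConjecture.Theorems

end
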